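/-
Copyright (c) 2026. All rights reserved.
Released under Apache 2.0 license as described in the file LICENSE.
Authors: abc-iut cell — seat abc-iut-w4-d104 (gen 4): row «COR29-L-A-ENGAGE», part (A) — [AbsTopIII]
Cor 2.9 with the local additive structures as INPUT data (print p.64 l.44–45), linearised by the charts.
-/
import Literature.AnabelianGeometry.AbsoluteAnabelian.ArchimedeanReconstructionCor29GermEngaged
import HarnessLib

/-!
# [AbsTopIII] Cor 2.9 with the local additive structures as INPUT: `+ₓ`, `(1/n)·ₓ` given, linearised by
# the chart at each NF-point

S. Mochizuki, *Topics in absolute anabelian geometry III* (bib key `MochizukiAbsTopIII2015`), Cor 2.9 (a)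
p.64 l.44 – p.65 l.2: "The local additive structures on `E^top` [cf. Corollary 2.7, (c)] determine local
additive structures on `X^top` [at NF-points].  Let `v⃗` be an element of a sufficiently small neighborhood
`U_X ⊆ X^top` of `x` that admits such a local additive structure."  PROOF-ONLY file (no definitions), part (A)
of row «COR29-L-A-ENGAGE» (L4-lead RULING #8g), sequel of `…Cor29GermEngaged.lean` (part (L)).

In p436603 / p438727 / p440549 and part (L) the local additive structure `a +ₓ b`, `(1/n)·ₓ v` at an NF-point
was the one TRANSPORTED FROM THE CHART of the package (`e_x⁻¹(e_x a + e_x b − e_x x)`, …) — abc-iut-f-075's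
reading R2 (ii): "print derives them from `E^top` via Cor 2.7 (c); the elliptically-admissible content lives
inside the hypothesis".  Here the local additive structures are INPUT DATA `ladd₀ x`, `scale₀ x` (whatever
Cor 2.7 (c) supplies at the NF-point `x` — the group law of the once-punctured elliptic curve transported
along the local homeomorphisms `X → H ← E` of the elliptic cuspidalization), and the ONE hypothesis tying them
to the chart package is that the chart `e_x` LINEARISES them on its domain `W_x`:
`ladd₀ x a b = e_x⁻¹(e_x a + e_x b − e_x x)` (`a, b ∈ W_x`) and `scale₀ x n v = e_x⁻¹(e_x x + (e_x v − e_x x)/n)`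
(`v ∈ W_x`, `n ≥ 1`).  (For the genuine `X_v` this holds with `e_x` the uniformising coordinate of `E` pulled
back to `x` — a holomorphic coordinate in which the transported group law is vector addition and in which the
NF-rational functions still have holomorphic expressions `G x f` (compositions of holomorphic maps); so the
chart package may be TAKEN in that coordinate.  -- TODO(general form): a linearising chart `ψ_x` different
from the function chart `e_x` with bi-holomorphic transition; reduces to this file by re-charting the package
along the transition, chain rule as in `hasDerivAt_ringEquiv_conj` of p436968.)

Over the sub-DAG statements of abc-iut-w5-d225 (p414208), for a chart package at `x` of a space `X` and input
data `ladd₀`, `scale₀` linearised by it, with the TOTAL scaling datum `scale := scale₀` on `U_x`, junk `x` off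
`U_x` (the junk convention of `NFCurveData.Cor29Refined`):

* `iterate_input_eq` / `isLocalAddDatumAt_input` (row a.r1 for the INPUT structure, incl. the clause
  `n · ((1/n)·ₓ v) = v` along the input addition), `scale_input_of_not_mem`;
* `iotaComputesLimits_input` (a.r2–a.r4), `iotaAdditive_input` (a.r6);
* `scalarFieldIso_input` (b.r2 for ANY `L`: additivity of the pinned scalar isomorphism for sums of germ
  automorphisms defined through the INPUT `+ₓ`);
* `NFCurveData.cor29Refined_of_chartPackage_input` (refined rows, genuine `D`, ANY `L`, input additive
  structures) and `NFCurveData.globalArchimedeanCompatibility'_of_chartPackage_input` (abc-iut-L4-t4's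
  successor statement of record), `NFCurveData.globalArchimedeanCompatibility'_genuine_germs_input` (GENUINE
  throughout: genuine NF-point predicate and extended evaluation of p438727, germ structure of part (L), input
  additive structures).

HONEST SCOPE: the chart package stays a NAMED hypothesis (analytic structure of `X_v(k_v)`, owed by Thm 1.9 /
Cor 2.8 outputs); the construction of `ladd₀`/`scale₀` FROM `E^top` (Cor 2.7 (c), `TorsionPointsDenseUniqueGroupLaw`,
the cuspidalization diagram) is not in the tree and enters only as the input data + the linearisation
hypothesis; functoriality record-only.  Refereed pre-IUT material; nothing here bears on the disputed
[IUTchIII] Cor. 3.12; typed ≠ endorsed.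
-/

noncomputable section

namespace Literature.AnabelianGeometry.AbsoluteAnabelian

open _root_.Set _root_.Topology _root_.Filter _root_.Metric _root_.Function
open ArchimedeanReconstruction ArchimedeanReconstruction.Cor29

/-! ## Rows of the sub-DAG for INPUT local additive structures linearised by a chart package -/

namespace ArchimedeanReconstruction.Cor29ChartPackage

variable {X : Type} [TopologicalSpace X]
variable {W : Set X} {e : X → ℂ} {e' : ℂ → X} {x : X} {r : ℝ}
variable {ladd₀ : X → X → X} {scale₀ : ℕ → X → X}

omit [TopologicalSpace X] in
/-- The iterates `w +ₓ (w +ₓ (⋯ +ₓ x))` of the INPUT addition, for `w = (1/n)·ₓ v` and `k ≤ n` steps, are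
`e⁻¹(e x + k (e v − e x)/n)` — they stay in the chart domain, where `+ₓ` is linear. (Auxiliary for a.r1.)
[cite: MochizukiAbsTopIII2015, Corollary 2.9 (a) p.65] -/
theorem iterate_input_eq (hxW : x ∈ W) (he'm : MapsTo e' (ball (e x) r) W) (hl : ∀ v ∈ W, e' (e v) = v)
    (hrt : ∀ w ∈ ball (e x) r, e (e' w) = w)
    (hladd : ∀ a ∈ W, ∀ b ∈ W, ladd₀ a b = e' (e a + e b - e x))
    {v : X} (hvr : ‖e v - e x‖ < r) {n : ℕ} (hn : 0 < n) {k : ℕ} (hk : k ≤ n) :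
    (ladd₀ (e' (e x + (e v - e x) / (n : ℂ))))^[k] x = e' (e x + (k : ℂ) * ((e v - e x) / (n : ℂ))) := by
  have hw : e x + (e v - e x) / (n : ℂ) ∈ ball (e x) r := add_div_nat_mem_ball hvr hn
  induction k with
  | zero => simp [hl x hxW]
  | succ k ih =>
    have hk' : k ≤ n := Nat.le_of_succ_le hk
    have hmemk : e x + (k : ℂ) * ((e v - e x) / (n : ℂ)) ∈ ball (e x) r :=
      add_nat_mul_div_nat_mem_ball hvr hn hk'
    rw [Function.iterate_succ_apply', ih hk', hladd _ (he'm hw) _ (he'm hmemk), hrt _ hw, hrt _ hmemk]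
    congr 1; push_cast; ring

open Classical in
/-- **Row Cor-29.a.r1 for INPUT local additive structures** linearised by the chart package at `x`: the input
addition `ladd₀ = (· +ₓ ·)` with the input division maps `scale₀ n = (1/n)·ₓ` — made TOTAL by the junk value `x`
off `U_x = {v ∈ W | ‖e v − e x‖ < r/2}` — is a local additive datum at `x` on `U_x`.
[cite: MochizukiAbsTopIII2015, Corollary 2.9 (a) pp.64–65] -/
theorem isLocalAddDatumAt_input (hr : 0 < r) (hWo : IsOpen W) (hxW : x ∈ W) (he : ContinuousOn e W)
    (he' : ContinuousOn e' (ball (e x) r)) (he'm : MapsTo e' (ball (e x) r) W)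
    (hl : ∀ v ∈ W, e' (e v) = v) (hrt : ∀ w ∈ ball (e x) r, e (e' w) = w)
    (hladd : ∀ a ∈ W, ∀ b ∈ W, ladd₀ a b = e' (e a + e b - e x))
    (hscale : ∀ n : ℕ, 0 < n → ∀ v ∈ W, scale₀ n v = e' (e x + (e v - e x) / (n : ℂ))) :
    IsLocalAddDatumAt ladd₀
      (fun n v => if v ∈ W ∧ ‖e v - e x‖ < r / 2 then scale₀ n v else x) x
      {v | v ∈ W ∧ ‖e v - e x‖ < r / 2} := by
  have h := isLocalAddDatumAt_pkg hr hWo hxW he he' he'm hl hrt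
  refine ⟨h.isOpen, h.mem, fun b hb => ?_, fun a ha => ?_, ?_, fun n hn v hv => ?_, fun n hn => ?_,
    fun n hn v hv => ?_⟩
  · rw [hladd x hxW b hb.1]; exact h.origin_left b hb
  · rw [hladd a ha.1 x hxW]; exact h.origin_right a ha
  · refine h.continuousOn_ladd.congr fun q hq => ?_
    obtain ⟨h1, h2⟩ := mem_prod.1 hq
    exact hladd q.1 h1.1 q.2 h2.1
  · have hv' : v ∈ W ∧ ‖e v - e x‖ < r / 2 := hv
    have hm := h.mapsTo_scale n hn hv
    simp only [if_pos hv'] at hm ⊢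
    rwa [hscale n hn v hv'.1]
  · refine (h.continuousOn_scale n hn).congr fun v hv => ?_
    have hv' : v ∈ W ∧ ‖e v - e x‖ < r / 2 := hv
    simp only [if_pos hv', hscale n hn v hv'.1]
  · have hv' : v ∈ W ∧ ‖e v - e x‖ < r / 2 := hv
    have hvr : ‖e v - e x‖ < r := by linarith [hv'.2]
    simp only [if_pos hv', hscale n hn v hv'.1]
    rw [iterate_input_eq hxW he'm hl hrt hladd hvr hn le_rfl]
    have hn' : (n : ℂ) ≠ 0 := by exact_mod_cast hn.ne'
    rw [mul_div_cancel₀ _ hn', add_sub_cancel, hl v hv'.1]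

omit [TopologicalSpace X] in
open Classical in
/-- The junk convention for the total input scaling datum: off `U_x` it returns `x`.
[cite: MochizukiAbsTopIII2015, Corollary 2.9 (a) p.65] -/
theorem scale_input_of_not_mem {v : X} (hv : v ∉ {v | v ∈ W ∧ ‖e v - e x‖ < r / 2}) (n : ℕ) :
    (fun n v => if v ∈ W ∧ ‖e v - e x‖ < r / 2 then scale₀ n v else x) n v = x := by
  simp only [mem_setOf_eq] at hv
  simp only [hv, if_false]

section Values

variable {𝕜 : Type*} [NontriviallyNormedField 𝕜]

open Classical in
/-- **Rows a.r2–a.r4 for INPUT local additive structures** (`IotaComputesLimits`): `ι(v) = κ(e v − e x) • id`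
computes the limits `lim n · F((1/n)·ₓ v)` along the INPUT division maps through `dF|_x := κ(G′(e x))`.
[cite: MochizukiAbsTopIII2015, Corollary 2.9 (a) p.65] -/
theorem iotaComputesLimits_input {Fn : Type*} (κ : ℂ ≃+* 𝕜) (hκ : Continuous κ) (hr : 0 < r) (hxW : x ∈ W)
    (he' : ContinuousOn e' (ball (e x) r)) (hl : ∀ v ∈ W, e' (e v) = v)
    (hrt : ∀ w ∈ ball (e x) r, e (e' w) = w)
    (hscale : ∀ n : ℕ, 0 < n → ∀ v ∈ W, scale₀ n v = e' (e x + (e v - e x) / (n : ℂ)))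
    {fval : Fn → X → 𝕜} {van : Fn → Prop} {G : Fn → ℂ → ℂ}
    (hG : ∀ f, van f → DifferentiableAt ℂ (G f) (e x) ∧ (∀ᶠ u in 𝓝 x, κ.symm (fval f u) = G f (e u)) ∧
      fval f x = 0) :
    IotaComputesLimits fval van (fun f => κ (deriv (G f) (e x)))
      (fun n v => if v ∈ W ∧ ‖e v - e x‖ < r / 2 then scale₀ n v else x)
      {v | v ∈ W ∧ ‖e v - e x‖ < r / 2} (fun v => (κ (e v - e x)) • (LinearMap.id : 𝕜 →ₗ[𝕜] 𝕜)) := by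
  intro v hv f hf
  have h := iotaComputesLimits_pkg κ hκ hr hxW he' hl hrt hG v hv f hf
  have hv' : v ∈ W ∧ ‖e v - e x‖ < r / 2 := hv
  refine h.congr' ?_
  filter_upwards [eventually_gt_atTop 0] with n hn
  simp only [if_pos hv', hscale n hn v hv'.1]

omit [TopologicalSpace X] in
open Classical in
/-- **Row a.r6 for INPUT local additive structures** (`IotaAdditive`): `ι(a +ₓ b) = ι a + ι b` on `U_x` and
`n • ι((1/n)·ₓ v) = ι v` for the input `+ₓ`, `(1/n)·ₓ`. [cite: MochizukiAbsTopIII2015, Corollary 2.9 (a) p.65] -/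
theorem iotaAdditive_input (κ : ℂ ≃+* 𝕜) (hr : 0 < r) (hrt : ∀ w ∈ ball (e x) r, e (e' w) = w)
    (hladd : ∀ a ∈ W, ∀ b ∈ W, ladd₀ a b = e' (e a + e b - e x))
    (hscale : ∀ n : ℕ, 0 < n → ∀ v ∈ W, scale₀ n v = e' (e x + (e v - e x) / (n : ℂ))) :
    IotaAdditive (𝕜 := 𝕜) ladd₀ (fun n v => if v ∈ W ∧ ‖e v - e x‖ < r / 2 then scale₀ n v else x)
      {v | v ∈ W ∧ ‖e v - e x‖ < r / 2} (fun v => (κ (e v - e x)) • (LinearMap.id : 𝕜 →ₗ[𝕜] 𝕜)) := by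
  have h := iotaAdditive_pkg (W := W) (e := e) (e' := e') (x := x) κ hr hrt
  refine ⟨fun a ha b hb hab => ?_, fun n hn v hv => ?_⟩
  · have hab' : e' (e a + e b - e x) ∈ {v | v ∈ W ∧ ‖e v - e x‖ < r / 2} := by
      rwa [← hladd a ha.1 b hb.1]
    rw [hladd a ha.1 b hb.1]
    exact h.1 a ha b hb hab'
  · have hv' : v ∈ W ∧ ‖e v - e x‖ < r / 2 := hv
    have h2 := h.2 n hn v hv
    simp only [if_pos hv'] at h2 ⊢
    rwa [hscale n hn v hv'.1]

/-- **Row b.r2 for INPUT local additive structures and ANY `L`** (`ScalarFieldIso`): the pinned scalar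
isomorphism `(isoUnits x)⁻¹ ≫ κ^×` of the multiplier action is additive for sums of germ automorphisms
defined through the INPUT addition `+ₓ` (the orbits `u · v` tend to `x`, so they enter the chart domain, where
`+ₓ` is linear). [cite: MochizukiAbsTopIII2015, Corollary 2.9 (b) p.65] -/
theorem scalarFieldIso_input (L : LocalLinearHolStructure X) (κ : ℂ ≃+* 𝕜) (κu : ℂˣ ≃ₜ* 𝕜ˣ)
    (hκu : ∀ c : ℂˣ, ((κu c : 𝕜ˣ) : 𝕜) = κ c)
    (hr : 0 < r) (hWo : IsOpen W) (hxW : x ∈ W) (he : ContinuousOn e W)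
    (hem : MapsTo e W (ball (e x) r)) (he' : ContinuousOn e' (ball (e x) r))
    (he'm : MapsTo e' (ball (e x) r) W) (hl : ∀ v ∈ W, e' (e v) = v)
    (hrt : ∀ w ∈ ball (e x) r, e (e' w) = w)
    (hladd : ∀ a ∈ W, ∀ b ∈ W, ladd₀ a b = e' (e a + e b - e x)) :
    ScalarFieldIso (𝕜 := 𝕜) L x
      (fun u v => e' (e x + ((((L.isoUnits x).symm u : ℂˣ) : ℂ) * (e v - e x))))
      ladd₀
      (fun v => (κ (e v - e x)) • (LinearMap.id : 𝕜 →ₗ[𝕜] 𝕜))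
      ((L.isoUnits x).symm.trans κu) := by
  have h := scalarFieldIso_pkg_of L κ κu hκu hr hWo hxW he hem he' he'm hl hrt
  refine ⟨h.1, fun φ ψ χ hsum => h.2 φ ψ χ ?_⟩
  beta_reduce at hsum ⊢
  filter_upwards [hsum, eventually_pkg_act hWo hxW he hem hrt ((((L.isoUnits x).symm φ : ℂˣ) : ℂ)),
    eventually_pkg_act hWo hxW he hem hrt ((((L.isoUnits x).symm ψ : ℂˣ) : ℂ))] with v hv hφ hψ
  rw [hv, hladd _ (he'm hφ.1) _ (he'm hψ.1)]

end Values

end ArchimedeanReconstruction.Cor29ChartPackage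

/-! ## Cor 2.9 for the genuine datum with INPUT local additive structures -/

namespace ArchimedeanReconstruction

open Cor29 Cor29ChartPackage

open Classical in
/-- **[AbsTopIII] Cor 2.9 for the GENUINE datum, refined rows, with the local additive structures as INPUT
DATA** `ladd₀ x = (· +ₓ ·)`, `scale₀ x n = (1/n)·ₓ` at the NF-points (print: determined by those of `E^top`,
Cor 2.7 (c)) — for ANY local linear holomorphic structure `L` acting through its multipliers, under the
chart-package hypothesis of p436603 PLUS the linearisation of the input structures by the charts on their
domains (`hladd`, `hscale`).  The total scaling datum is `scale₀ x` on `U_x`, junk `x` off `U_x`.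
[cite: MochizukiAbsTopIII2015, Corollary 2.9 pp.64–65] -/
theorem NFCurveData.cor29Refined_of_chartPackage_input (D : NFCurveData) (L : LocalLinearHolStructure D.Xtop)
    (isNFPoint : D.Xtop → Prop)
    (W : D.Xtop → Set D.Xtop) (e : D.Xtop → D.Xtop → ℂ) (e' : D.Xtop → ℂ → D.Xtop) (r : D.Xtop → ℝ)
    (hr : ∀ x, isNFPoint x → 0 < r x) (hW : ∀ x, isNFPoint x → IsOpen (W x) ∧ x ∈ W x)
    (he : ∀ x, isNFPoint x → ContinuousOn (e x) (W x) ∧ MapsTo (e x) (W x) (ball (e x x) (r x)))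
    (he' : ∀ x, isNFPoint x →
      ContinuousOn (e' x) (ball (e x x) (r x)) ∧ MapsTo (e' x) (ball (e x x) (r x)) (W x))
    (hl : ∀ x, isNFPoint x → ∀ v ∈ W x, e' x (e x v) = v)
    (hrt : ∀ x, isNFPoint x → ∀ w ∈ ball (e x x) (r x), e x (e' x w) = w)
    (ladd₀ : D.Xtop → D.Xtop → D.Xtop → D.Xtop) (scale₀ : D.Xtop → ℕ → D.Xtop → D.Xtop)
    (hladd : ∀ x, isNFPoint x → ∀ a ∈ W x, ∀ b ∈ W x, ladd₀ x a b = e' x (e x a + e x b - e x x))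
    (hscale : ∀ x, isNFPoint x → ∀ n : ℕ, 0 < n → ∀ v ∈ W x,
      scale₀ x n v = e' x (e x x + (e x v - e x x) / (n : ℂ)))
    (fval : D.Fn → D.Xtop → D.kv) (vanishesAt : D.Fn → D.Xtop → Prop) (G : D.Xtop → D.Fn → ℂ → ℂ)
    (κ : ℂ ≃+* D.kv) (hκ : Continuous κ) (hκ' : Continuous κ.symm)
    (hG : ∀ x, isNFPoint x → ∀ f, vanishesAt f x → DifferentiableAt ℂ (G x f) (e x x) ∧
      (∀ᶠ u in 𝓝 x, κ.symm (fval f u) = G x f (e x u)) ∧ fval f x = 0)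
    (hvan : ∀ f x, vanishesAt f x → fval f x = 0)
    (hspan : ∀ x, isNFPoint x → ∃ f, vanishesAt f x ∧ deriv (G x f) (e x x) ≠ 0) :
    D.Cor29Refined L isNFPoint (fun _ => D.kv) (fun x f => κ (deriv (G x f) (e x x))) vanishesAt ladd₀
      (fun x n v => if v ∈ W x ∧ ‖e x v - e x x‖ < r x / 2 then scale₀ x n v else x) fval
      (fun x u v => e' x (e x x + ((((L.isoUnits x).symm u : ℂˣ) : ℂ) * (e x v - e x x)))) := by
  refine ⟨(D.cor29Refined_of_chartPackage_of L isNFPoint W e e' r hr hW he he' hl hrt fval vanishesAt G κ hκ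
      hκ' hG hvan hspan).span, hvan, ?_⟩
  refine ⟨fun x => {v | v ∈ W x ∧ ‖e x v - e x x‖ < r x / 2},
    fun x v => (κ (e x v - e x x)) • (LinearMap.id : D.kv →ₗ[D.kv] D.kv),
    fun x => (L.isoUnits x).symm.trans (unitsOfFieldIso κ hκ hκ'),
    fun x hx => ?_, fun x₁ x₂ _ _ => scalarCompatibleWithTrans_of L (unitsOfFieldIso κ hκ hκ') x₁ x₂⟩
  obtain ⟨hWo, hxW⟩ := hW x hx
  obtain ⟨hec, hem⟩ := he x hx
  obtain ⟨he'c, he'm⟩ := he' x hx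
  refine ⟨isLocalAddDatumAt_input (hr x hx) hWo hxW hec he'c he'm (hl x hx) (hrt x hx) (hladd x hx)
      (hscale x hx),
    iotaComputesLimits_input κ hκ (hr x hx) hxW he'c (hl x hx) (hrt x hx) (hscale x hx) (hG x hx),
    iotaIsEmbedding_pkg κ hκ hκ' hec he'c hem (hl x hx) (fun v hv => hv.1),
    iotaAdditive_input κ (hr x hx) (hrt x hx) (hladd x hx) (hscale x hx), iota_self_pkg κ,
    scalarFieldIso_input L κ (unitsOfFieldIso κ hκ hκ') (fun c => rfl) (hr x hx) hWo hxW hec hem he'c he'm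
      (hl x hx) (hrt x hx) (hladd x hx),
    fun v hv n => scale_input_of_not_mem hv n⟩

open Classical in
/-- **[AbsTopIII] Cor 2.9, abc-iut-L4-t4's SUCCESSOR statement of record `GlobalArchimedeanCompatibility'`, for
the GENUINE datum, ANY `L`, and INPUT local additive structures** linearised by the chart package.
[cite: MochizukiAbsTopIII2015, Corollary 2.9 pp.64–65] -/
theorem NFCurveData.globalArchimedeanCompatibility'_of_chartPackage_input (D : NFCurveData)
    (L : LocalLinearHolStructure D.Xtop) (isNFPoint : D.Xtop → Prop)
    (W : D.Xtop → Set D.Xtop) (e : D.Xtop → D.Xtop → ℂ) (e' : D.Xtop → ℂ → D.Xtop) (r : D.Xtop → ℝ)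
    (hr : ∀ x, isNFPoint x → 0 < r x) (hW : ∀ x, isNFPoint x → IsOpen (W x) ∧ x ∈ W x)
    (he : ∀ x, isNFPoint x → ContinuousOn (e x) (W x) ∧ MapsTo (e x) (W x) (ball (e x x) (r x)))
    (he' : ∀ x, isNFPoint x →
      ContinuousOn (e' x) (ball (e x x) (r x)) ∧ MapsTo (e' x) (ball (e x x) (r x)) (W x))
    (hl : ∀ x, isNFPoint x → ∀ v ∈ W x, e' x (e x v) = v)
    (hrt : ∀ x, isNFPoint x → ∀ w ∈ ball (e x x) (r x), e x (e' x w) = w)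
    (ladd₀ : D.Xtop → D.Xtop → D.Xtop → D.Xtop) (scale₀ : D.Xtop → ℕ → D.Xtop → D.Xtop)
    (hladd : ∀ x, isNFPoint x → ∀ a ∈ W x, ∀ b ∈ W x, ladd₀ x a b = e' x (e x a + e x b - e x x))
    (hscale : ∀ x, isNFPoint x → ∀ n : ℕ, 0 < n → ∀ v ∈ W x,
      scale₀ x n v = e' x (e x x + (e x v - e x x) / (n : ℂ)))
    (fval : D.Fn → D.Xtop → D.kv) (vanishesAt : D.Fn → D.Xtop → Prop) (G : D.Xtop → D.Fn → ℂ → ℂ)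
    (κ : ℂ ≃+* D.kv) (hκ : Continuous κ) (hκ' : Continuous κ.symm)
    (hG : ∀ x, isNFPoint x → ∀ f, vanishesAt f x → DifferentiableAt ℂ (G x f) (e x x) ∧
      (∀ᶠ u in 𝓝 x, κ.symm (fval f u) = G x f (e x u)) ∧ fval f x = 0)
    (hvan : ∀ f x, vanishesAt f x → fval f x = 0)
    (hspan : ∀ x, isNFPoint x → ∃ f, vanishesAt f x ∧ deriv (G x f) (e x x) ≠ 0) :
    GlobalArchimedeanCompatibility' D L isNFPoint (fun _ => D.kv) (fun x f => κ (deriv (G x f) (e x x)))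
      vanishesAt ladd₀ (fun x n v => if v ∈ W x ∧ ‖e x v - e x x‖ < r x / 2 then scale₀ x n v else x) fval
      (fun x u v => e' x (e x x + ((((L.isoUnits x).symm u : ℂˣ) : ℂ) * (e x v - e x x)))) := by
  have hR := D.cor29Refined_of_chartPackage_input L isNFPoint W e e' r hr hW he he' hl hrt ladd₀ scale₀ hladd
    hscale fval vanishesAt G κ hκ hκ' hG hvan hspan
  refine ⟨(D.globalArchimedeanCompatibility_of_refined _ _ _ _ _ _ _ _ _ hR).limit_depends_on_differential,
    ?_⟩
  refine ⟨fun x => {v | v ∈ W x ∧ ‖e x v - e x x‖ < r x / 2},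
    fun x v => (κ (e x v - e x x)) • (LinearMap.id : D.kv →ₗ[D.kv] D.kv),
    fun _ _ => κ, fun _ _ => hκ, fun _ _ => hκ', fun x hx => ?_, fun x₁ x₂ _ _ => ?_⟩
  · obtain ⟨hWo, hxW⟩ := hW x hx
    obtain ⟨hec, hem⟩ := he x hx
    obtain ⟨he'c, he'm⟩ := he' x hx
    refine ⟨isLocalAddDatumAt_input (hr x hx) hWo hxW hec he'c he'm (hl x hx) (hrt x hx) (hladd x hx)
        (hscale x hx),
      iotaComputesLimits_input κ hκ (hr x hx) hxW he'c (hl x hx) (hrt x hx) (hscale x hx) (hG x hx),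
      iotaIsEmbedding_pkg κ hκ hκ' hec he'c hem (hl x hx) (fun v hv => hv.1),
      iotaAdditive_input κ (hr x hx) (hrt x hx) (hladd x hx) (hscale x hx), ?_⟩
    rw [fieldIsoScalar_eq_trans]
    exact scalarFieldIso_input L κ (unitsOfFieldIso κ hκ hκ') (fun c => rfl) (hr x hx) hWo hxW hec hem he'c
      he'm (hl x hx) (hrt x hx) (hladd x hx)
  · exact fieldIsoScalar_compatible L x₁ x₂ κ hκ hκ'

open Classical in
/-- **[AbsTopIII] Cor 2.9 — the successor statement of record, GENUINE throughout, with INPUT local additive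
structures**: genuine `D`, genuine NF-point predicate and extended evaluation (p438727), the GERM structure
`L := planeStructure.comap (fun x ↦ e_x x)` of part (L) with the germ action through the charts, and the local
additive structures `ladd₀`, `scale₀` as input data linearised by the charts — under the chart-package
hypothesis.  This is the strongest form the interface shim supports: every parameter of the statement is
either the genuine term of the datum or named input data with its stated compatibility.
[cite: MochizukiAbsTopIII2015, Corollary 2.9 pp.64–65] -/
theorem NFCurveData.globalArchimedeanCompatibility'_genuine_germs_input (D : NFCurveData)
    (W : D.Xtop → Set D.Xtop) (e : D.Xtop → D.Xtop → ℂ) (e' : D.Xtop → ℂ → D.Xtop) (r : D.Xtop → ℝ)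
    (G : D.Xtop → D.Fn → ℂ → ℂ) (κ : ℂ ≃+* D.kv) (hκ : Continuous κ) (hκ' : Continuous κ.symm)
    (hpkg : ∀ x : D.Xtop,
      (∃ (P : D.Pt) (s : {x : ℕ → D.Pt // D.IsCauchy x}), Quot.mk _ s = x ∧
        ∀ f : D.Fn, D.eval f P ≠ none → Tendsto (fun j => D.valv f (s.1 j)) atTop (𝓝 (D.valv f P))) →
      0 < r x ∧ IsOpen (W x) ∧ x ∈ W x ∧ ContinuousOn (e x) (W x) ∧
        MapsTo (e x) (W x) (ball (e x x) (r x)) ∧ ContinuousOn (e' x) (ball (e x x) (r x)) ∧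
        MapsTo (e' x) (ball (e x x) (r x)) (W x) ∧ (∀ v ∈ W x, e' x (e x v) = v) ∧
        ∀ w ∈ ball (e x x) (r x), e x (e' x w) = w)
    (ladd₀ : D.Xtop → D.Xtop → D.Xtop → D.Xtop) (scale₀ : D.Xtop → ℕ → D.Xtop → D.Xtop)
    (hlin : ∀ x : D.Xtop,
      (∃ (P : D.Pt) (s : {x : ℕ → D.Pt // D.IsCauchy x}), Quot.mk _ s = x ∧
        ∀ f : D.Fn, D.eval f P ≠ none → Tendsto (fun j => D.valv f (s.1 j)) atTop (𝓝 (D.valv f P))) →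
      (∀ a ∈ W x, ∀ b ∈ W x, ladd₀ x a b = e' x (e x a + e x b - e x x)) ∧
        ∀ n : ℕ, 0 < n → ∀ v ∈ W x, scale₀ x n v = e' x (e x x + (e x v - e x x) / (n : ℂ)))
    (hG : ∀ x : D.Xtop,
      (∃ (P : D.Pt) (s : {x : ℕ → D.Pt // D.IsCauchy x}), Quot.mk _ s = x ∧
        ∀ f : D.Fn, D.eval f P ≠ none → Tendsto (fun j => D.valv f (s.1 j)) atTop (𝓝 (D.valv f P))) →
      ∀ f : D.Fn, limUnder atTop (fun j => D.valv f ((Quot.out x).1 j)) = 0 →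
        DifferentiableAt ℂ (G x f) (e x x) ∧
          ∀ᶠ u in 𝓝 x, κ.symm (limUnder atTop (fun j => D.valv f ((Quot.out u).1 j))) = G x f (e x u))
    (hspan : ∀ x : D.Xtop,
      (∃ (P : D.Pt) (s : {x : ℕ → D.Pt // D.IsCauchy x}), Quot.mk _ s = x ∧
        ∀ f : D.Fn, D.eval f P ≠ none → Tendsto (fun j => D.valv f (s.1 j)) atTop (𝓝 (D.valv f P))) →
      ∃ f : D.Fn, limUnder atTop (fun j => D.valv f ((Quot.out x).1 j)) = 0 ∧ deriv (G x f) (e x x) ≠ 0) :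
    GlobalArchimedeanCompatibility' D (Cor29Model.planeStructure.comap (fun x : D.Xtop => e x x))
      (fun x => ∃ (P : D.Pt) (s : {x : ℕ → D.Pt // D.IsCauchy x}), Quot.mk _ s = x ∧
        ∀ f : D.Fn, D.eval f P ≠ none → Tendsto (fun j => D.valv f (s.1 j)) atTop (𝓝 (D.valv f P)))
      (fun _ => D.kv) (fun x f => κ (deriv (G x f) (e x x)))
      (fun f x => limUnder atTop (fun j => D.valv f ((Quot.out x).1 j)) = 0)
      ladd₀ (fun x n v => if v ∈ W x ∧ ‖e x v - e x x‖ < r x / 2 then scale₀ x n v else x)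
      (fun f x => limUnder atTop (fun j => D.valv f ((Quot.out x).1 j)))
      (fun x u v => e' x (Cor29Model.act (e x x) u (e x v))) :=
  D.globalArchimedeanCompatibility'_of_chartPackage_input (Cor29Model.planeStructure.comap (fun x => e x x)) _
    W e e' r (fun x hx => (hpkg x hx).1)
    (fun x hx => ⟨(hpkg x hx).2.1, (hpkg x hx).2.2.1⟩)
    (fun x hx => ⟨(hpkg x hx).2.2.2.1, (hpkg x hx).2.2.2.2.1⟩)
    (fun x hx => ⟨(hpkg x hx).2.2.2.2.2.1, (hpkg x hx).2.2.2.2.2.2.1⟩)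
    (fun x hx => (hpkg x hx).2.2.2.2.2.2.2.1) (fun x hx => (hpkg x hx).2.2.2.2.2.2.2.2)
    ladd₀ scale₀ (fun x hx => (hlin x hx).1) (fun x hx => (hlin x hx).2)
    _ _ G κ hκ hκ' (fun x hx f hf => ⟨(hG x hx f hf).1, (hG x hx f hf).2, hf⟩) (fun _ _ h => h) hspan

end ArchimedeanReconstruction

end Literature.AnabelianGeometry.AbsoluteAnabelian

end
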